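import Literature.Computability.AlgebraicComplexity.ZeroWindowStrings
import HarnessLib

/-!
# Zero windows of strings with prescribed zero blocks (the site structure)

Topic `Literature/Computability/AlgebraicComplexity`; sequel of `ZeroWindowStrings.lean`. For
the `T₂`-type sum of the sliding-window witness one has to sum `θ^{zwin}` over the binary strings
of length `L` whose windows at the SITE positions `a, a + d, a + 2d, …` are all zero. Cutting such
a string at its first zero block, `l = g ++ 0^{t+1} ++ l'` (`|g| = a`), gives

* `zwin_append_zeros_append` — `zwin(A ++ 0^{t+1} ++ B) = zwin A + min(trail A, t) + 1 +
  min(lead B, t) + zwin B` (the windows overlapping the block from either side);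
* `V_succ`, `VA_succ` — renewal recursions for the shaped sums `V` (no entry reward) and `VA`
  (entry reward `min(lead, t)`), in terms of `FA` and `Q` of `ZeroWindowStrings.lean`;
* `VA_eq`, `V_eq` — the closed forms, e.g.
  `V(d, r, n + t) = θ^r · FA(d) · Q(d - t - 1)^{r-1} · FA(n - r d - 1)`.

## References

* M. Kumar, S. Saraf, *On the power of homogeneous depth 4 arithmetic circuits*, SIAM J. Comput.
  46 (2017) 336–387, §8.5–§9 (the sums these bound, for `IMM`).
-/

noncomputable section

namespace Literature.Computability.AlgebraicComplexity

namespace ZeroWindow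

open Finset

/-! ### The two-block lemma -/

/-- The leading run of `0^a ++ B`. [folklore] -/
theorem lead_replicate_append (a : ℕ) (B : List Bool) :
    lead (List.replicate a false ++ B) = a + lead B := by
  induction a with
  | zero => simp
  | succ a ih => rw [List.replicate_succ, List.cons_append, lead_cons_false, ih]; omega

/-- The zero windows of `0^a ++ B`: those inside/overlapping the zero prefix, and those of `B`.
[folklore] -/
theorem zwin_replicate_append (t a : ℕ) (B : List Bool) :
    zwin t (List.replicate a false ++ B) = min a (a + lead B - t) + zwin t B := by
  induction a with
  | zero => simp
  | succ a ih =>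
    rw [List.replicate_succ, List.cons_append, zwin_cons_false, ih, lead_replicate_append]
    split_ifs with h <;> omega

/-- The leading run of a concatenation. [folklore] -/
theorem lead_append (A B : List Bool) :
    lead (A ++ B) = if lead A = A.length then A.length + lead B else lead A := by
  induction A with
  | nil => simp
  | cons c A ih =>
    cases c
    · simp only [List.cons_append, lead_cons_false, ih, List.length_cons]
      split_ifs <;> omega
    · simp

/-- **Two-block lemma**: the zero windows of `A ++ 0^{t+1} ++ B` are those of `A`, the
`min(trail A, t)` windows starting near the end of `A`, the block itself, the `min(lead B, t)`
windows starting inside the block, and those of `B`. [folklore] -/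
theorem zwin_append_zeros_append (t : ℕ) (A B : List Bool) :
    zwin t (A ++ List.replicate (t + 1) false ++ B) =
      zwin t A + min (lead A.reverse) t + 1 + min (lead B) t + zwin t B := by
  induction A with
  | nil =>
    rw [List.nil_append, zwin_replicate_append]
    simp only [zwin_nil, List.reverse_nil, lead_nil, Nat.zero_min, zero_add]
    omega
  | cons c A ih =>
    rw [List.cons_append, List.cons_append, zwin_cons, ih, zwin_cons, List.reverse_cons,
      lead_append A.reverse [c], List.length_reverse, List.append_assoc, lead_append]
    by_cases hA : lead A = A.length
    · -- `A` is all `false`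
      have hAr : lead A.reverse = A.length := by
        rw [eq_replicate_of_lead_eq_length A hA, List.reverse_replicate, lead_replicate,
          List.length_replicate]
      rw [if_pos hA, if_pos hAr, lead_replicate_append, hAr]
      cases c
      · simp only [true_and, lead_cons_false, lead_nil, zero_add]
        split_ifs <;> omega
      · simp only [Bool.true_eq_false, false_and, if_false, lead_cons_true, add_zero]
    · have hAr : lead A.reverse ≠ A.length := fun h => hA (by
        have h2 : A = List.replicate A.length false := by
          have := eq_replicate_of_lead_eq_length A.reverse (by rw [h, List.length_reverse])
          rw [List.length_reverse] at this
          conv_lhs => rw [← List.reverse_reverse A, this, List.reverse_replicate]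
        conv_lhs => rw [h2]
        rw [lead_replicate])
      rw [if_neg hA, if_neg hAr]
      cases c
      · simp only [true_and]
        split_ifs <;> omega
      · simp

/-- The leading run of a prefix. [folklore] -/
theorem lead_take (l : List Bool) (m : ℕ) : lead (l.take m) = min (lead l) m := by
  induction l generalizing m with
  | nil => simp
  | cons c l ih =>
    cases m with
    | zero => simp
    | succ m =>
      cases c
      · rw [List.take_succ_cons, lead_cons_false, lead_cons_false, ih, Nat.succ_min_succ]
      · simp

/-- `min(lead, t)` sees only a prefix of length `≥ t`. [folklore] -/
theorem min_lead_take {t m : ℕ} (h : t ≤ m) (l : List Bool) : min (lead (l.take m)) t = min (lead l) t := by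
  rw [lead_take, min_assoc, min_eq_right h]

/-- `min(lead (A ++ B), t) = min(lead A, t)` when `|A| ≥ t`. [folklore] -/
theorem min_lead_append {t : ℕ} (A B : List Bool) (h : t ≤ A.length) :
    min (lead (A ++ B)) t = min (lead A) t := by
  rw [lead_append]
  split_ifs with hA <;> omega

/-! ### Cutting at a zero window -/

/-- The window of `l` at position `p` (`t + 1` bits). Same as `SlidingWindow.winL`; kept local to
this string file. [folklore] -/
def wnd (t : ℕ) (l : List Bool) (p : ℕ) : List Bool := (l.drop p).take (t + 1)

/-- **Cut**: a string with a zero window at `p` is `take p ++ 0^{t+1} ++ drop (p+t+1)`.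
[folklore] -/
theorem eq_take_append_zeros_append_drop {t : ℕ} {l : List Bool} {p : ℕ}
    (h : wnd t l p = List.replicate (t + 1) false) :
    l = l.take p ++ List.replicate (t + 1) false ++ l.drop (p + t + 1) := by
  conv_lhs => rw [← List.take_append_drop p l, ← List.take_append_drop (t + 1) (l.drop p)]
  rw [List.drop_drop, List.append_assoc, ← wnd, h, ← Nat.add_assoc]

/-- Windows of a suffix. [folklore] -/
theorem wnd_drop (t : ℕ) (l : List Bool) (q p : ℕ) : wnd t (l.drop q) p = wnd t l (q + p) := by
  rw [wnd, wnd, List.drop_drop]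

/-- Windows of a prefix, inside the prefix. [folklore] -/
theorem wnd_take {t : ℕ} (l : List Bool) {m p : ℕ} (h : p + t + 1 ≤ m) : wnd t (l.take m) p = wnd t l p := by
  rw [wnd, wnd, List.drop_take, List.take_take]
  congr 1; omega

/-- Windows of `A ++ C` inside `A`. [folklore] -/
theorem wnd_append_left {t : ℕ} (A C : List Bool) {p : ℕ} (h : p + t + 1 ≤ A.length) :
    wnd t (A ++ C) p = wnd t A p := by
  rw [wnd, wnd, List.drop_append_of_le_length (by omega), List.take_append_of_le_length
    (by rw [List.length_drop]; omega)]

/-- Windows of `A ++ C` inside `C`. [folklore] -/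
theorem wnd_append_right {t : ℕ} (A C : List Bool) (p : ℕ) :
    wnd t (A ++ C) (A.length + p) = wnd t C p := by
  rw [wnd, wnd, List.drop_append, List.drop_eq_nil_of_le (by omega), List.nil_append,
    Nat.add_sub_cancel_left]

/-! ### Shaped sums -/

/-- The site structure: zero windows at the positions `a + j d`, `j < k`. [folklore] -/
def ShapeZ (t d a k : ℕ) (l : List Bool) : Prop :=
  ∀ j, j < k → wnd t l (a + j * d) = List.replicate (t + 1) false

/-- Decidability of `ShapeZ` (a bounded quantifier). [folklore] -/
instance (t d a k : ℕ) (l : List Bool) : Decidable (ShapeZ t d a k l) := by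
  unfold ShapeZ; exact Nat.decidableBallLT k _

/-- No sites: every string has the shape. [folklore] -/
theorem shapeZ_zero (t d a : ℕ) (l : List Bool) : ShapeZ t d a 0 l := fun _ h => absurd h (Nat.not_lt_zero _)

/-- The shaped sum `V_k(a, L) = ∑_{|l| = L, ShapeZ} θ^{zwin l}` (no entry reward). [folklore] -/
def V (θ : ℝ) (t d a k L : ℕ) : ℝ :=
  strSum L fun l => if ShapeZ t d a k l then θ ^ zwin t l else 0

/-- The shaped sum with entry reward `VA_k(a, L) = ∑_{|l| = L, ShapeZ} θ^{zwin l + min(lead l, t)}`.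
[folklore] -/
def VA (θ : ℝ) (t d a k L : ℕ) : ℝ :=
  strSum L fun l => if ShapeZ t d a k l then θ ^ (zwin t l + min (lead l) t) else 0

/-- `V_0 = F`. [folklore] -/
theorem V_zero (θ : ℝ) (t d a L : ℕ) : V θ t d a 0 L = F θ t L := by
  unfold V F; exact congrArg (strSum L) (funext fun l => if_pos (shapeZ_zero t d a l))

/-- `VA_0 = FA`. [folklore] -/
theorem VA_zero (θ : ℝ) (t d a L : ℕ) : VA θ t d a 0 L = FA θ t L := by
  unfold VA FA; exact congrArg (strSum L) (funext fun l => if_pos (shapeZ_zero t d a l))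

/-- The shape of `g ++ 0^{t+1} ++ l'` (`|g| = a`) with `k + 1` sites is the shape of `l'` with
`k` sites and first piece `d - t - 1` (for `t + 1 ≤ d`). [folklore] -/
theorem shapeZ_append_iff {t d a k : ℕ} (hd : t + 1 ≤ d) (g l' : List Bool) (hg : g.length = a) :
    ShapeZ t d a (k + 1) (g ++ List.replicate (t + 1) false ++ l') ↔ ShapeZ t d (d - t - 1) k l' := by
  have hlen : (g ++ List.replicate (t + 1) false).length = a + (t + 1) := by
    rw [List.length_append, hg, List.length_replicate]
  have hpos : ∀ j, a + (j + 1) * d = (g ++ List.replicate (t + 1) false).length + (d - t - 1 + j * d) := by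
    intro j; rw [hlen, Nat.succ_mul]; omega
  constructor
  · intro h j hj
    have h1 := h (j + 1) (by omega)
    rw [hpos j, wnd_append_right] at h1
    exact h1
  · intro h j hj
    rcases Nat.eq_zero_or_pos j with rfl | hj0
    · -- the block itself
      rw [Nat.zero_mul, add_zero, wnd, List.append_assoc, List.drop_append_of_le_length hg.ge,
        List.drop_eq_nil_of_le hg.le, List.nil_append, List.take_append_of_le_length (by simp),
        List.take_of_length_le (by simp)]
    · have h1 := h (j - 1) (by omega)
      obtain ⟨j', rfl⟩ : ∃ j', j = j' + 1 := ⟨j - 1, by omega⟩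
      rw [Nat.add_sub_cancel] at h1
      rw [hpos j', wnd_append_right]
      exact h1

/-- **The cut bijection as a sum identity**: for `k + 1` sites and `L = a + (t + 1) + L'`,
summing `Φ` over the shaped strings of length `L` is summing `Φ(g ++ 0^{t+1} ++ l')` over all `g`
of length `a` and the shaped `l'` of length `L'`. [folklore] -/
theorem strSum_shape_succ {t d a k L' : ℕ} (hd : t + 1 ≤ d) (Φ : List Bool → ℝ) :
    strSum (a + (t + 1) + L') (fun l => if ShapeZ t d a (k + 1) l then Φ l else 0) =
      strSum a fun g => strSum L' fun l' =>
        if ShapeZ t d (d - t - 1) k l' then Φ (g ++ List.replicate (t + 1) false ++ l') else 0 := by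
  classical
  unfold strSum
  rw [← Finset.sum_product']
  -- restrict both sides to the shaped strings and biject
  rw [← Finset.sum_filter_add_sum_filter_not Finset.univ (fun l : List.Vector Bool (a + (t + 1) + L') =>
    ShapeZ t d a (k + 1) l.toList)]
  rw [Finset.sum_congr rfl (fun l hl => if_pos (Finset.mem_filter.1 hl).2),
    Finset.sum_congr rfl (fun l hl => if_neg (Finset.mem_filter.1 hl).2), Finset.sum_const_zero,
    add_zero]
  rw [← Finset.sum_filter_add_sum_filter_not (Finset.univ ×ˢ Finset.univ)
    (fun p : List.Vector Bool a × List.Vector Bool L' => ShapeZ t d (d - t - 1) k p.2.toList)]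
  rw [Finset.sum_congr rfl (fun p hp => if_pos (Finset.mem_filter.1 hp).2),
    Finset.sum_congr rfl (fun p hp => if_neg (Finset.mem_filter.1 hp).2), Finset.sum_const_zero,
    add_zero]
  -- the bijection `l ↦ (take a l, drop (a + t + 1) l)`
  refine Finset.sum_nbij'
    (fun l => (⟨l.toList.take a, by rw [List.length_take, l.toList_length]; omega⟩,
      ⟨l.toList.drop (a + t + 1), by rw [List.length_drop, l.toList_length]; omega⟩))
    (fun p => ⟨p.1.toList ++ List.replicate (t + 1) false ++ p.2.toList, by
      rw [List.length_append, List.length_append, p.1.toList_length, p.2.toList_length,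
        List.length_replicate]⟩)
    (fun l hl => ?_) (fun p hp => ?_) (fun l hl => ?_) (fun p _ => ?_) (fun l hl => ?_)
  rotate_right
  · -- the summand: `l = take ++ 0^{t+1} ++ drop`
    rw [Finset.mem_filter] at hl
    have hcut := eq_take_append_zeros_append_drop (hl.2 0 (Nat.succ_pos k))
    simp only [Nat.zero_mul, add_zero] at hcut
    exact congrArg Φ hcut
  · -- shape is transported
    rw [Finset.mem_filter] at hl ⊢
    refine ⟨Finset.mem_product.2 ⟨Finset.mem_univ _, Finset.mem_univ _⟩, ?_⟩
    have hcut := eq_take_append_zeros_append_drop (hl.2 0 (Nat.succ_pos k))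
    simp only [Nat.zero_mul, add_zero] at hcut
    have h := hl.2
    rw [hcut, show a + t + 1 = a + t + 1 from rfl] at h
    exact (shapeZ_append_iff hd _ _ (by rw [List.length_take, l.toList_length]; omega)).1 h
  · rw [Finset.mem_filter] at hp ⊢
    exact ⟨Finset.mem_univ _, (shapeZ_append_iff hd _ _ p.1.toList_length).2 hp.2⟩
  · -- left inverse: the cut
    rw [Finset.mem_filter] at hl
    apply List.Vector.eq
    have hcut := eq_take_append_zeros_append_drop (hl.2 0 (Nat.succ_pos k))
    simp only [Nat.zero_mul, add_zero] at hcut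
    exact hcut.symm
  · -- right inverse: take/drop of the concatenation
    obtain ⟨g, l'⟩ := p
    have hg := g.toList_length
    refine Prod.ext (List.Vector.eq _ _ ?_) (List.Vector.eq _ _ ?_)
    · change (g.toList ++ List.replicate (t + 1) false ++ l'.toList).take a = g.toList
      rw [List.append_assoc, List.take_append_of_le_length hg.ge, List.take_of_length_le hg.le]
    · change (g.toList ++ List.replicate (t + 1) false ++ l'.toList).drop (a + t + 1) = l'.toList
      rw [show a + t + 1 = (g.toList ++ List.replicate (t + 1) false).length by
        rw [List.length_append, hg, List.length_replicate]; omega, List.drop_left]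

/-! ### The renewal recursions and closed forms -/

/-- **`V_{k+1}(a, a + (t+1) + L') = θ · FA(a) · VA_k(d-t-1, L')`** (cut at the first block; the
`min(trail g, t)` windows before it, the block, and the `min(lead l', t)` windows after it).
[folklore] -/
theorem V_succ (θ : ℝ) {t d : ℕ} (hd : t + 1 ≤ d) (a k L' : ℕ) :
    V θ t d a (k + 1) (a + (t + 1) + L') = θ * FA θ t a * VA θ t d (d - t - 1) k L' := by
  unfold V
  rw [strSum_shape_succ hd]
  have inner : ∀ g : List Bool, strSum L' (fun l' => if ShapeZ t d (d - t - 1) k l' then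
      θ ^ zwin t (g ++ List.replicate (t + 1) false ++ l') else 0) =
      (θ * VA θ t d (d - t - 1) k L') * θ ^ (zwin t g + min (lead g.reverse) t) := by
    intro g
    rw [mul_comm, VA, ← strSum_mul, ← strSum_mul]
    congr 1
    ext l'
    split_ifs with h
    · rw [zwin_append_zeros_append]; ring
    · ring
  simp_rw [inner]
  rw [strSum_mul, strSum_trail_eq_FA]
  ring

/-- **`VA_{k+1}(a, a + (t+1) + L') = θ · Q(a) · VA_k(d-t-1, L')`** for `t ≤ a` (the entry reward
`min(lead, t)` of the whole string is that of its first piece). [folklore] -/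
theorem VA_succ (θ : ℝ) {t d a : ℕ} (hd : t + 1 ≤ d) (ha : t ≤ a) (k L' : ℕ) :
    VA θ t d a (k + 1) (a + (t + 1) + L') = θ * Q θ t a * VA θ t d (d - t - 1) k L' := by
  unfold VA
  rw [strSum_shape_succ hd]
  have inner : ∀ g : List Bool, g.length = a → strSum L' (fun l' => if ShapeZ t d (d - t - 1) k l' then
      θ ^ (zwin t (g ++ List.replicate (t + 1) false ++ l') +
        min (lead (g ++ List.replicate (t + 1) false ++ l')) t) else 0) =
      (θ * strSum L' (fun l' => if ShapeZ t d (d - t - 1) k l' then θ ^ (zwin t l' + min (lead l') t) else 0)) *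
        θ ^ (min (lead g) t + zwin t g + min (lead g.reverse) t) := by
    intro g hg
    rw [mul_comm, ← strSum_mul, ← strSum_mul]
    congr 1
    ext l'
    split_ifs with h
    · rw [zwin_append_zeros_append, List.append_assoc, min_lead_append _ _ (by rw [hg]; exact ha)]
      ring
    · ring
  rw [show strSum a (fun g => strSum L' fun l' => if ShapeZ t d (d - t - 1) k l' then
      θ ^ (zwin t (g ++ List.replicate (t + 1) false ++ l') +
        min (lead (g ++ List.replicate (t + 1) false ++ l')) t) else 0) =
      strSum a (fun g => (θ * strSum L' (fun l' => if ShapeZ t d (d - t - 1) k l' then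
        θ ^ (zwin t l' + min (lead l') t) else 0)) *
        θ ^ (min (lead g) t + zwin t g + min (lead g.reverse) t)) from
    Finset.sum_congr rfl fun g _ => inner g.toList g.toList_length]
  rw [strSum_mul, Q]
  ring

/-- **Closed form for `VA`**: with pieces of length `a = d - t - 1 ≥ t`,
`VA_k(a, k d + L') = (θ Q(a))^k · FA(L')`. [folklore] -/
theorem VA_eq (θ : ℝ) {t d : ℕ} (hd : 2 * t + 1 ≤ d) (k L' : ℕ) :
    VA θ t d (d - t - 1) k (k * d + L') = (θ * Q θ t (d - t - 1)) ^ k * FA θ t L' := by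
  induction k generalizing L' with
  | zero => rw [Nat.zero_mul, zero_add, VA_zero, pow_zero, one_mul]
  | succ k ih =>
    have h1 : (k + 1) * d + L' = (d - t - 1) + (t + 1) + (k * d + L') := by
      rw [Nat.succ_mul]; omega
    rw [h1, VA_succ θ (by omega) (by omega), ih, pow_succ]
    ring

/-- **Closed form for the site-shaped sum**: `r + 1` sites, first piece of length `d`
(pieces between sites of length `d - t - 1 ≥ t`, last piece of length `L'`):
`V_{r+1}(d, d + (t+1) + (r d + L')) = θ · FA(d) · (θ Q(d-t-1))^r · FA(L')`. [folklore] -/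
theorem V_eq (θ : ℝ) {t d : ℕ} (hd : 2 * t + 1 ≤ d) (r L' : ℕ) :
    V θ t d d (r + 1) (d + (t + 1) + (r * d + L')) =
      θ * FA θ t d * ((θ * Q θ t (d - t - 1)) ^ r * FA θ t L') := by
  rw [V_succ θ (by omega), VA_eq θ hd]

end ZeroWindow

end Literature.Computability.AlgebraicComplexity
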